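import Summits.HubbardSuperconductivity.HubbardSuperconductivity.Theorems.SoloBlindSchurTransfer
import Literature.MathematicalPhysics.QuantumLattice.FockRelabel
import HarnessLib

/-!
# Space-group essential uniqueness + one good ground state ⟹ the summit

The concrete form of `SoloBlindSchurTransfer`: the symmetry family is the SPACE GROUP of the
square torus — the lattice translations `U_v = fockTranslate v` and the point group
`U_γ = fockD4 γ`, `γ ∈ D₄` — acting on Fock space by orbital relabelling. Both commute with the
Hubbard Hamiltonian (`relabel_translate_hubbardTorus`, `relabel_d4Perm_hubbardTorus`), preserve the
`(N, S^z)` sectors, hence map sector ground states to sector ground states, and both fix the d-wave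
order observable `(√2Δ_d)†(√2Δ_d)` (`relabel_translate_pairField_conjTranspose_mul`,
`relabel_d4Perm_pairField_conjTranspose_mul`: `Δ_d ↦ χ_{B₁}(γ)Δ_d` with `χ² = 1`); their adjoints
are again translations / point-group elements. So
`hubbardSuperconductivity_of_irreducible_groundSpaces` specialises to:

* `hubbardSuperconductivity_of_spaceGroup_irreducible` — THE SUMMIT follows from: for some `U > 0`,
  `δ ∈ (0,1/2)`, `c > 0` and all large even `L`, (i) SPACE-GROUP ESSENTIAL UNIQUENESS of the doped
  sector ground state — every subspace of sector ground states (and `0`) stable under all `U_v` and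
  all `U_γ` is `⊥` or contains every sector ground state — and (ii) ONE unit sector ground state
  with `re⟨ψ, (√2Δ_d)†(√2Δ_d)ψ⟩ ≥ cL⁴`.

(i) is a statement about `H` alone ("the ground state of the doped sector is unique up to lattice
symmetry"); it is open for every `U > 0` away from half filling. (ii) is what the weak-coupling
(Kohn–Luttinger / renormalisation-group) theory of the model is about. References: Lieb, PRL 62
(1989) 1201 (uniqueness at half filling); Scalapino, Phys. Rep. 250 (1995) §2.
-/

namespace Summit.HubbardSuperconductivity.HubbardSuperconductivity.Theorems

open Matrix Finset Literature.MathematicalPhysics.QuantumLattice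
  Literature.MathematicalPhysics.QuantumFieldTheory GaugeTwist WithLp
open Literature.Probability.LatticeModels (TorusSite)
open scoped ComplexConjugate ComplexOrder

/-- **Space-group essential uniqueness + one good ground state ⟹ `HubbardSuperconductivity`.**
With `H = hubbardTorus 2 L 1 U`, `L = n+1` even and large, and the sector `(2⌊(1-δ)L²/2⌋, S^z=0)`:
if (i) every subspace consisting of sector ground states (and `0`) that is stable under all lattice
translations `fockTranslate v` and all point-group unitaries `fockD4 γ` is `⊥` or contains every
sector ground state, and (ii) one unit sector ground state has d-wave order `≥ cL⁴`, uniformly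
(`U > 0`, `δ ∈ (0,1/2)`, `c > 0` fixed), then `HubbardSuperconductivity`. [this work] -/
theorem hubbardSuperconductivity_of_spaceGroup_irreducible
    (h : ∃ U : ℝ, 0 < U ∧ ∃ δ ∈ Set.Ioo (0 : ℝ) (1 / 2), ∃ c : ℝ, 0 < c ∧ ∃ L₀ : ℕ,
      ∀ n : ℕ, Even (n + 1) → L₀ ≤ n + 1 →
        (∀ W : Submodule ℂ (Fock (Orb (FermionTorus 2 (n + 1)))),
          (∀ w ∈ W, w = 0 ∨ IsGroundStateInSector (hubbardTorus 2 (n + 1) 1 U)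
            (2 * ⌊(1 - δ) * ((n + 1 : ℕ) : ℝ) ^ 2 / 2⌋₊) 0 w) →
          (∀ v : TorusSite 2 (n + 1), ∀ w ∈ W, (fockTranslate v).val *ᵥ w ∈ W) →
          (∀ γ : DihedralGroup 4, ∀ w ∈ W, (fockD4 (L := n + 1) γ).val *ᵥ w ∈ W) →
          W = ⊥ ∨ ∀ ψ, IsGroundStateInSector (hubbardTorus 2 (n + 1) 1 U)
            (2 * ⌊(1 - δ) * ((n + 1 : ℕ) : ℝ) ^ 2 / 2⌋₊) 0 ψ → ψ ∈ W) ∧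
        (∃ ψ, IsGroundStateInSector (hubbardTorus 2 (n + 1) 1 U)
            (2 * ⌊(1 - δ) * ((n + 1 : ℕ) : ℝ) ^ 2 / 2⌋₊) 0 ψ ∧ star ψ ⬝ᵥ ψ = 1 ∧
          c * ((n + 1 : ℕ) : ℝ) ^ 4 ≤ (expect
            ((pairField dWaveFormFactor (n + 1))ᴴ * pairField dWaveFormFactor (n + 1)) ψ).re)) :
    HubbardSuperconductivity := by
  obtain ⟨U, hU, δ, hδ, c, hc, L₀, hb⟩ := h
  refine hubbardSuperconductivity_of_irreducible_groundSpaces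
    ⟨U, hU, δ, hδ, c, hc, L₀, fun n hn hL => ?_⟩
  obtain ⟨hirr, hone⟩ := hb n hn hL
  set H := hubbardTorus 2 (n + 1) 1 U with hH
  set N : ℕ := 2 * ⌊(1 - δ) * ((n + 1 : ℕ) : ℝ) ^ 2 / 2⌋₊
  set O := (pairField dWaveFormFactor (n + 1))ᴴ * pairField dWaveFormFactor (n + 1) with hO
  -- the symmetry family: translations and the point group `D₄`
  let G : Set (Matrix (Finset (Orb (FermionTorus 2 (n + 1))))
      (Finset (Orb (FermionTorus 2 (n + 1)))) ℂ) :=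
    Set.range (fun v : TorusSite 2 (n + 1) => (fockTranslate v).val) ∪
      Set.range (fun γ : DihedralGroup 4 => (fockD4 (L := n + 1) γ).val)
  have hd : dWaveFormFactor = sWave ∨ dWaveFormFactor = extendedSWave ∨
      dWaveFormFactor = dWaveFormFactor := Or.inr (Or.inr rfl)
  -- adjoints stay in the family
  have hadjT : ∀ v : TorusSite 2 (n + 1),
      ((fockTranslate v).val)ᴴ = (fockTranslate (-v)).val := fun v => by
    rw [fockTranslate_neg]; rfl
  have hadjD : ∀ γ : DihedralGroup 4,
      ((fockD4 (L := n + 1) γ).val)ᴴ = (fockD4 (L := n + 1) γ⁻¹).val := fun γ => by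
    rw [map_inv]; rfl
  -- ground states go to ground states
  have hgsT : ∀ v : TorusSite 2 (n + 1), ∀ ψ, IsGroundStateInSector H N 0 ψ →
      IsGroundStateInSector H N 0 ((fockTranslate v).val *ᵥ ψ) := fun v ψ hψ =>
    hψ.fockTranslate_mulVec v (relabel_translate_hubbardTorus v 1 U)
  have hgsD : ∀ γ : DihedralGroup 4, ∀ ψ, IsGroundStateInSector H N 0 ψ →
      IsGroundStateInSector H N 0 ((fockD4 (L := n + 1) γ).val *ᵥ ψ) := fun γ ψ hψ =>
    hψ.fockD4_mulVec γ (relabel_d4Perm_hubbardTorus γ 1 U)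
  refine ⟨G, ?_, ?_, fun W hW hGW => hirr W hW (fun v w hw => hGW _ (Or.inl ⟨v, rfl⟩) w hw)
    (fun γ w hw => hGW _ (Or.inr ⟨γ, rfl⟩) w hw), hone⟩
  · -- (a) every element of `G` commutes with `Δ_d†Δ_d`
    rintro g (⟨v, rfl⟩ | ⟨γ, rfl⟩)
    · exact ((fockRelabel_commute_of_relabel_eq _
        (relabel_translate_pairField_conjTranspose_mul dWaveFormFactor v)).eq).symm
    · exact ((fockRelabel_commute_of_relabel_eq _
        (relabel_d4Perm_pairField_conjTranspose_mul γ dWaveFormFactor hd)).eq).symm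
  · -- (b) `g` and `gᴴ` map ground states to ground states
    rintro g (⟨v, rfl⟩ | ⟨γ, rfl⟩) ψ hψ
    · refine ⟨Or.inr (hgsT v ψ hψ), Or.inr ?_⟩
      rw [hadjT]
      exact hgsT (-v) ψ hψ
    · refine ⟨Or.inr (hgsD γ ψ hψ), Or.inr ?_⟩
      rw [hadjD]
      exact hgsD γ⁻¹ ψ hψ

end Summit.HubbardSuperconductivity.HubbardSuperconductivity.Theorems
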